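import Literature.Geometry.Lorentzian.IsometryProofs
import HarnessLib

/-!
# Pulling back a smooth FAMILY of bilinear-form fields on a vector space along a fixed smooth map

Topic `Literature/Geometry/Manifold` (namespace `Literature.Geometry.Manifold`). The parametric
companion of the tree's `contMDiff_pullbackBilin_holds` / `contMDiffAt_pullbackBilin_of_contMDiffAt`
(`IsometryProofs.lean`, `BilinSectionTransport.lean`) in the situation of a chart: the target is a
normed vector space `F` (a manifold modelled on itself, tangent spaces `= F`, identity
trivialisations), the fields of bilinear forms on `F` come in a family `c p : F → (F →L F →L ℝ)`
depending on a parameter `p` in a manifold `P`, and `f : N → F` is a fixed map. Then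

* `contMDiffAt_pullbackBilin_family` — if `f` is `C^{n+1}` at `y₀` and `(p, z) ↦ c p z` is
  `C^n` at `(p₀, f y₀)`, the map `(p, y) ↦ (y, (f^*(c p))_y)` from `P × N` into the bundle
  `Hom(TN, Hom(TN, ℝ))` — `(f^*(c p))_y (v, w) = c p (f y) (df_y v, df_y w)` (`pullbackBilin`) — is
  `C^n` at `(p₀, y₀)`: in tangent coordinates of `N` at `y₀` it reads
  `(p, y) ↦ Φ(y)ᵀ · c p (f y) · Φ(y)` with `Φ` the differential of `f` read in the chart
  (`ContMDiffAt.mfderiv_const`), a `C^n` expression;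
* `contMDiffOn_pullbackBilin_family` — the same on `S × U` for `U` open, `f` smooth on `U` and
  `c` smooth on `S × f(U)`-containing opens.

This is the smoothness-in-parameters of the standard operation "read a smooth family of tensors
given in a chart back on the manifold" (O'Neill 1983, Ch. 3, Def. 3.9: pullback of covariant
tensors; Lee 2013, Prop. 13.3 pattern), used for families of initial data produced in the chart of
an asymptotically flat end (rescaled bodies with a moving scale, breathing diffeomorphisms).
Everything is proved; no definitions, no named facts.

## References

* B. O'Neill, *Semi-Riemannian geometry* (1983), Ch. 3, Def. 3.9 and Lemma 3.35. [ONeill1983]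
* J. M. Lee, *Introduction to Smooth Manifolds*, 2nd ed. (2013), Prop. 13.3. [LeeSmoothManifolds2013]
-/

noncomputable section

open Bundle Set Function Filter
open scoped Manifold ContDiff Topology

namespace Literature.Geometry.Manifold

open Literature.Geometry.Lorentzian

variable {EP : Type*} [NormedAddCommGroup EP] [NormedSpace ℝ EP] {HP : Type*} [TopologicalSpace HP]
  {IP : ModelWithCorners ℝ EP HP} {P : Type*} [TopologicalSpace P] [ChartedSpace HP P]
  {E' : Type*} [NormedAddCommGroup E'] [NormedSpace ℝ E'] {H' : Type*} [TopologicalSpace H']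
  {I' : ModelWithCorners ℝ E' H'} {N : Type*} [TopologicalSpace N] [ChartedSpace H' N]
  [IsManifold I' ∞ N]
  {F : Type*} [NormedAddCommGroup F] [NormedSpace ℝ F]
  {n : ℕ∞ω}

/-- **Pulling back a `C^n` family of bilinear-form fields on a vector space along a map which is
`C^{n+1}` at a point.** Let `f : N → F` be `C^{n+1}` at `y₀` (target a normed space, tangent
spaces `= F`) and `c : P → F → (F →L F →L ℝ)` with `(p, z) ↦ c p z` of class `C^n` at
`(p₀, f y₀)`. Then `(p, y) ↦ (y, (f^*(c p))_y)` is `C^n` at `(p₀, y₀)` as a map into the bundle of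
bilinear forms on `TN`. In tangent coordinates of `N` at `y₀` the fibre coordinate is
`Φ(y)ᵀ (c p (f y)) Φ(y)`, `Φ(y) = df_y` read in the chart (the trivialisations of `TF` are the
identity, `TangentBundle.continuousLinearMapAt_model_space`). [cite: ONeill1983, Ch. 3, Def. 3.9 and Lemma 3.35] -/
theorem contMDiffAt_pullbackBilin_family {f : N → F} {y₀ : N} {p₀ : P}
    (hf : ContMDiffAt I' 𝓘(ℝ, F) (n + 1) f y₀)
    {c : P → F → F →L[ℝ] F →L[ℝ] ℝ}
    (hc : ContMDiffAt (IP.prod 𝓘(ℝ, F)) 𝓘(ℝ, F →L[ℝ] F →L[ℝ] ℝ) n (uncurry c) (p₀, f y₀)) :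
    ContMDiffAt (IP.prod I') (I'.prod 𝓘(ℝ, E' →L[ℝ] E' →L[ℝ] ℝ)) n
      (fun q : P × N ↦ TotalSpace.mk' (E' →L[ℝ] E' →L[ℝ] ℝ)
        (E := fun y : N ↦ TangentSpace I' y →L[ℝ] TangentSpace I' y →L[ℝ] ℝ) q.2
        (pullbackBilin (I := 𝓘(ℝ, F)) (I' := I') f
          (show Π z : F, TangentSpace 𝓘(ℝ, F) z →L[ℝ] TangentSpace 𝓘(ℝ, F) z →L[ℝ] ℝ from c q.1) q.2))
      (p₀, y₀) := by
  rw [contMDiffAt_bilin_iff]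
  refine ⟨contMDiffAt_snd, ?_⟩
  set τN := trivializationAt E' (TangentSpace I' : N → Type _) y₀ with hτN
  set τF := trivializationAt F (TangentSpace 𝓘(ℝ, F) : F → Type _) (f y₀) with hτF
  -- `Φ y = df_y` read in the charts at `y₀` and `f y₀`, `C^n` at `y₀`
  set Φ : N → E' →L[ℝ] F := inTangentCoordinates I' 𝓘(ℝ, F) id f (fun y ↦ mfderiv I' 𝓘(ℝ, F) f y) y₀
    with hΦ
  have hΦs : ContMDiffAt I' 𝓘(ℝ, E' →L[ℝ] F) n Φ y₀ := ContMDiffAt.mfderiv_const hf le_rfl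
  have hΦs' : ContMDiffAt (IP.prod I') 𝓘(ℝ, E' →L[ℝ] F) n (fun q : P × N ↦ Φ q.2) (p₀, y₀) :=
    hΦs.comp (p₀, y₀) contMDiffAt_snd
  -- `(p, y) ↦ c p (f y)` is `C^n` at `(p₀, y₀)`
  have hf' : ContMDiffAt I' 𝓘(ℝ, F) n f y₀ := hf.of_le le_self_add
  have hcf : ContMDiffAt (IP.prod I') 𝓘(ℝ, F →L[ℝ] F →L[ℝ] ℝ) n (fun q : P × N ↦ c q.1 (f q.2))
      (p₀, y₀) := by
    have h2 : ContMDiffAt (IP.prod I') (IP.prod 𝓘(ℝ, F)) n (fun q : P × N ↦ (q.1, f q.2)) (p₀, y₀) :=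
      contMDiffAt_fst.prodMk (hf'.comp (p₀, y₀) contMDiffAt_snd)
    exact hc.comp (p₀, y₀) h2
  -- the composite `q ↦ Φᵀ (c q.1 (f q.2)) Φ`
  have h1 : ContMDiffAt (IP.prod I') 𝓘(ℝ, E' →L[ℝ] F →L[ℝ] ℝ) n
      (fun q : P × N ↦ (c q.1 (f q.2)).comp (Φ q.2)) (p₀, y₀) :=
    ContMDiffAt.clm_comp hcf hΦs'
  have h2 : ContMDiffAt (IP.prod I') 𝓘(ℝ, (F →L[ℝ] ℝ) →L[ℝ] (E' →L[ℝ] ℝ)) n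
      (fun q : P × N ↦ (Φ q.2).precomp ℝ) (p₀, y₀) :=
    hΦs'.clm_precomp (F₃ := ℝ)
  have hcomp : ContMDiffAt (IP.prod I') 𝓘(ℝ, E' →L[ℝ] E' →L[ℝ] ℝ) n
      (fun q : P × N ↦ ((Φ q.2).precomp ℝ).comp ((c q.1 (f q.2)).comp (Φ q.2))) (p₀, y₀) :=
    ContMDiffAt.clm_comp h2 h1
  refine hcomp.congr_of_eventuallyEq ?_
  -- near `(p₀, y₀)` the coordinate expression of the section is that composite
  have hev : ∀ᶠ q : P × N in 𝓝 (p₀, y₀), f q.2 ∈ τF.baseSet := by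
    have h := hf.continuousAt.preimage_mem_nhds
      (τF.open_baseSet.mem_nhds (FiberBundle.mem_baseSet_trivializationAt' (f y₀)))
    exact (continuousAt_snd (p := (p₀, y₀))).preimage_mem_nhds h
  filter_upwards [hev] with q hfq
  ext e e'
  have key : ∀ v : E', Φ q.2 v = mfderiv I' 𝓘(ℝ, F) f q.2 (τN.symmL ℝ q.2 v) := by
    intro v
    simp only [hΦ, inTangentCoordinates, ContinuousLinearMap.inCoordinates,
      ContinuousLinearMap.coe_comp, comp_apply, id_eq, TangentBundle.continuousLinearMapAt_model_space]
    rfl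
  simp only [ContinuousLinearMap.coe_comp, comp_apply, ContinuousLinearMap.precomp_apply,
    pullbackBilin_apply, key]
  rfl

/-- **Pulling back a smooth family of bilinear-form fields on a vector space along a smooth map,
on open sets.** If `f : N → F` is `C^{n+1}` on the open `U ⊆ N` and `(p, z) ↦ c p z` is `C^n` on
an open `W ⊆ P × F` containing `(p, f y)` for all `(p, y) ∈ S × U`, then the family of pulled-back
fields `(p, y) ↦ (f^*(c p))_y` is `C^n` on `S × U`. [cite: ONeill1983, Ch. 3, Def. 3.9 and Lemma 3.35] -/
theorem contMDiffOn_pullbackBilin_family {f : N → F} {U : Set N} (hU : IsOpen U)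
    (hf : ContMDiffOn I' 𝓘(ℝ, F) (n + 1) f U)
    {c : P → F → F →L[ℝ] F →L[ℝ] ℝ} {S : Set P} {W : Set (P × F)} (hW : IsOpen W)
    (hc : ContMDiffOn (IP.prod 𝓘(ℝ, F)) 𝓘(ℝ, F →L[ℝ] F →L[ℝ] ℝ) n (uncurry c) W)
    (hmem : ∀ p ∈ S, ∀ y ∈ U, (p, f y) ∈ W) :
    ContMDiffOn (IP.prod I') (I'.prod 𝓘(ℝ, E' →L[ℝ] E' →L[ℝ] ℝ)) n
      (fun q : P × N ↦ TotalSpace.mk' (E' →L[ℝ] E' →L[ℝ] ℝ)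
        (E := fun y : N ↦ TangentSpace I' y →L[ℝ] TangentSpace I' y →L[ℝ] ℝ) q.2
        (pullbackBilin (I := 𝓘(ℝ, F)) (I' := I') f
          (show Π z : F, TangentSpace 𝓘(ℝ, F) z →L[ℝ] TangentSpace 𝓘(ℝ, F) z →L[ℝ] ℝ from c q.1) q.2))
      (S ×ˢ U) := by
  rintro ⟨p, y⟩ ⟨hp, hy⟩
  exact (contMDiffAt_pullbackBilin_family (hf.contMDiffAt (hU.mem_nhds hy))
    (hc.contMDiffAt (hW.mem_nhds (hmem p hp y hy)))).contMDiffWithinAt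

end Literature.Geometry.Manifold

end
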